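import Summits.Schanuel.Schanuel.Theses.RigidCore
import Literature.NumberTheory.Transcendental.ExpPointsExamples
import Literature.NumberTheory.Transcendental.ZariskiDimBounds
import Literature.NumberTheory.Transcendental.ExpPointsShapiroModel
import Literature.NumberTheory.Transcendental.ExpPointsCubicAtoms
import Literature.NumberTheory.Transcendental.ExpPointsCbrtTwoModel
import Literature.NumberTheory.Transcendental.TrdegZariskiDim
import Literature.NumberTheory.Transcendental.TrdegZariskiDimConverse
import Literature.NumberTheory.Transcendental.ExpPointsPrimeReduction
import Literature.NumberTheory.Transcendental.GoldenGermLogDensity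
import Literature.NumberTheory.Transcendental.GeometricHitRigidity
import Literature.NumberTheory.Transcendental.GoldenHitRigidity

/-!
# Disproof of `SparsityTwo` — findings (cdisprove, crux stmt-Schanuel-0971, route RigidCore)

Crux: `SparsityTwo := ∀ W ⊆ ℂ² × ℂ², IsDefinedOver ⊥ W → zariskiDim ℂ W < 2 →
  Set.Finite {x | LinearIndependent ℚ x ∧ (x, eˣ) ∈ W}` (the counted set is
`indepExpPoints W` of `ExpPointsExamples.lean`, definitionally: `sparsityTwo_iff`).

## Verdict: NO KILL POSSIBLE — the crux is a theorem of SC(2), KERNEL-CHECKED (§5)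
`sparsityTwo_of_schanuel : Schanuel → SparsityTwo` and `not_schanuel_of_not_sparsityTwo` (via the
landed `TrdegZariskiDim.lean`, p72297: a point of a ℚ-variety `W` with `zariskiDim ℂ W < d` has
`trdeg_ℚ < d`, proved by transporting the point into an algebraic closure of `ℂ(t_S)`; so SC(2)
makes the counted set EMPTY, `indepExpPoints_eq_empty_of_schanuel`). Hence every refutation of
`SparsityTwo` is a counterexample to Schanuel's conjecture; the disprover's job reduces to
(a) load-bearing analysis, (b) tightness, (c) refuted strengthenings, (d) calibration from below
(which OPEN problems any proof must settle). Finiteness is formally WEAKER than SC(2) (= emptiness):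
one stray point on a ℚ-curve would not refute the crux (no ℚ-algebraic self-map of a generic
ℚ-curve reproduces graph points; translations by `2πik` are not defined over ℚ̄).

## Index (cycle 1 = landed Literature companions; cycle 2 = this file, §3)
* §1 LOAD-BEARING (all three hypotheses necessary; explicit infinite families, no transcendence
  theory used) — wrappers over `ExpPointsExamples.lean` (landed p68347):
  `sparsityTwo_false_without_definedOverQ` (line `{x₂=1,y₁=1,y₂=e}` over ℚ(e): closedness +
  dim ≤ 1 do not suffice ⇒ FIELD-OF-DEFINITION-BLIND METHODS (o-minimal counting, Ax–Schanuel,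
  complex analysis on `W`) CANNOT PROVE THE CRUX), `sparsityTwo_false_without_dimBound`,
  `sparsityTwo_false_with_dim_lt_three` (ℚ-plane `{x₂=1,y₁=1}`: the bound `< 2` is tight),
  `sparsityTwo_false_without_linIndep` (ℚ-line `{y₁=y₂=1, x₂=2x₁}` carries `(2πik, 4πik)`:
  ℚ-independence cannot be weakened to `x₁x₂ ≠ 0, x₁ ≠ x₂`).
* §2 CALIBRATIONS, cycle 1 (landed p68924, p69037): `SparsityTwo ⇒ e^c ∉ ℚ (c ∈ ℚˣ)`,
  `⇒ real Hermite–Lindemann`, `⇒ finiteness for the Shapiro model pair (slope √2, Cayley)`.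
  CORRECTION (triage r1-1 §A(ii), r1-2 §A): the √2-model `shapiroW` is NOT an open instance —
  on the axis the two phase equations give `N − √2M = −√2/(π²M) + O(M⁻³)`, so the integer norm
  `N² − 2M²` tends to `−4/π² ∉ ℤ`: finitely many hits by Galois-norm integrality (Theorem-P class,
  quadratic slope + torsion phase). It stays here as a DECIDABLE benchmark (a support theorem a
  prover can land), not as a measure of open strength.
* §3 CALIBRATIONS, cycle 2 (landed as `ExpPointsCubicAtoms.lean` p71195 and
  `ExpPointsCbrtTwoModel.lean` p71550; wrappers here; OPEN instances, one per residual atom named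
  by the five crux cards): `sparsityTwo_imp_rootChain_finite` — the ROOT-CHAIN curve
  `{x₂ = x₁³, y₂ = 1, (1−x₁)(y₁+1) = 2}` (one Cayley factor, one Puiseux/root chain): the crux
  implies that `e^{t} = (1+t)/(1−t)` has only finitely many solutions with `t³ ∈ 2πiℤ∖{0}`, i.e.
  `‖π²M³/2 + 1/(π²M) + O(M⁻³)‖ = 0` for finitely many odd `M` — a depth-1 Weyl-cubic target for
  `π²`; each single hit already violates SC(2) (`trdeg ℚ(t, π, eᵗ) = 1`), no unconditional method
  is known (irrationality-measure arguments would need `μ(π²) < 2`; Pila–Wilkie/BNZ give only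
  `X^ε`/polylog counts; six exponentials needs algebraic values).
  `sparsityTwo_imp_cubicCayley_finite` (§3b) — the DOUBLE-CAYLEY cubic `{x₂ = x₁³, both Cayley}`
  ("two inexact chains, non-linear end"): finitely many common zeros `t ≠ 0` of `(1−t)eᵗ−(1+t)` and
  `(1−t³)e^{t³}−(1+t³)`; hits `‖π²M³/2 − 1/2 + 1/(π²M) + …‖ = 0`.
  `sparsityTwo_imp_cbrtTwoCayley_finite` (§3c) — the SLOPE-∛2 double Cayley `{x₂³ = 2x₁³, both
  Cayley}` (the `Sim(β, ℚ(β)π⁻²)` atom, `[ℚ(β):ℚ] = 3`, depth 1, no norm obstruction): finitely many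
  common zeros `t ≠ 0` of `(1−t)eᵗ−(1+t)` and `(1−βt)e^{βt}−(1+βt)`, `β³ = 2`.
  Together §3a–c formalise one explicit open instance for EACH residual atom named by the five crux
  cards (root/Puiseux chain; two inexact chains with non-linear end; linear slope of degree ≥ 3).
* §4 WHY IT RESISTS (docstring `resists`).
* §5 UPPER CALIBRATION (landed as `TrdegZariskiDim.lean` p72297; wrappers here):
  `sparsityTwo_of_schanuelRank_two`, `sparsityTwo_of_schanuel`, `indepExpPoints_eq_empty_of_schanuel`,
  `not_schanuel_of_not_sparsityTwo` — the crux sits between SC(2) (above) and the three open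
  coincidence problems of §3 plus real Hermite–Lindemann (below).
* §6 SC(2) IN THE CRUX'S LANGUAGE (landed as `TrdegZariskiDimConverse.lean` p72508; wrappers):
  `schanuelRank_two_iff_emptiness` — SC(2) ⟺ every ℚ-defined `W` with `zariskiDim ℂ W < 2` has
  `indepExpPoints W = ∅`; `counterexample_mem_indepExpPoints` — every would-be SC(2) counterexample
  lies on such a `W`. So the crux is EXACTLY "each ℚ-curve carries finitely many SC(2)
  counterexamples" (finiteness vs emptiness is the only gap to SC(2)), and the least dimension of a
  ℚ-variety through a point is its transcendence degree (both halves kernel-checked).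
  §6b (`eTowerLine`): the gap is REAL — on the ℚ-lines `{x₁=1, y₁=x₂, y₂=a x₂+b}` the crux holds
  trivially (`indepExpPoints ⊆ {(1,e)}`) while emptiness is `e^e ≠ a e + b`, i.e. for `a = 0` the
  open irrationality of `e^e` (`indepExpPoints_eTowerLine_eq_empty_iff`).
* §7 REDUCTIONS any proof may use (landed as `ExpPointsPrimeReduction.lean` p72569):
  `sparsityTwo_iff_prime` — WLOG `W = Z(𝔮)` with `𝔮 ⊆ ℚ[x₁,x₂,y₁,y₂]` PRIME (ℚ-irreducible `W`).
* `-- Targets` (line cusp-germ-schneider-sparsity, picked 2026-08-16): E, H, ★ are SC(2)-theorems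
  (`wStubs_of_schanuelRank_two`) hence irrefutable; R, Im landed; S (pure analysis) is the only killable
  stub — not broken; new power-density tight example `e = 2, A = w, g = (√(1−z²)−1)/z`, hits `N = m²+1`;
  interpolation-cost heuristic why transcendental tails cannot have log-dense hits.
* §8 NOTE: the route's pending "uniformity lemma" (dependent points lie on finitely many rational
  lines) was attacked and found PROVABLE (paper proof in §8; ≤ one direction per ℚ-component).
* §9 (cycle 3, g3): STUB S (`stub_cuspZeroLogDensity`, the only field-blind open stub) — NOT KILLABLE:
  §9a kernel-checked SHARPNESS (`stubS_false_without_transcendence`: the algebraic golden/Pell tail with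
  the irrational jet `φ·X` has `≥ ⌊log₃ X⌋` hits below `X`, so S's conclusion fails without transcendence
  at exactly the `log X` scale; Literature twin `GoldenGermLogDensity.lean`); §9b exact existence criterion
  for a counterexample (divided differences); §9c NEW Lucas-abscissa rigidity theorem (positive-density
  re-use of Pell/Lucas abscissae with ANY integer ordinates forces an algebraic tail — Szemerédi + Lucas
  second differences; elementary for full classes); §9c′ its GEOMETRIC case KERNEL-CHECKED
  (`stubS_hits_rigid_on_geometric`: infinitely many hit triples
  `λcᵐ, λcᵐ⁺¹, λcᵐ⁺²` with a linear jet force `g ≡ 0`; Literature twin `GeometricHitRigidity.lean`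
  p75707) and its GOLDEN case kernel-checked in Literature `GoldenHitRigidity.lean` (p75995,
  `stubS_hits_rigid_on_golden`: Fibonacci 4-progressions of hits force `g = κ·goldenGerm`);
  §9d the adversarial CLUSTERED regime for Schneider's
  method and why the planner's near-record-low start (or a constant-size auxiliary polynomial + a
  stall-chain lemma) defeats it; §9e S's conclusion PROVED on structured abscissae: UNCONDITIONALLY on
  geometric progressions (Literature `GeometricHitDensity.lean`, p76236 ACCEPTED,
  `geomHitExp_density_zero`: Roth + rigidity ⇒ `{m : λcᵐ hit}` of a non-zero tail with a linear jet
  has upper density `0`, i.e. those hits number `o(log Y)` below `Y`, even eventually — the first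
  unconditional instance of Theorem S beyond Runge's rational jets), and on the FIBONACCI abscissae for
  TRANSCENDENTAL tails modulo the named fact `SzemerediFinitary 4` (Literature `HitDensitySzemeredi.lean`,
  p76402: abstract "Szemerédi(k) + no late k-APs ⇒ density 0" + `goldenLinear_implies_algebraic` +
  `fibHitExp_density_zero_of_szemeredi_four`). (Imports of these two files into this work-file wait for
  the farm build; statements are quoted in §9e below.) Open content of the line = ★ alone.
* NUMERICS (evidence `nearmiss.py` + `nearmiss_result_M2e5.json`; 60-digit Decimal arithmetic;
  reduced run odd `M ≤ 2·10⁵` attached, full run `M ≤ 2·10⁶` = kit job j007659, auto-attaches):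
  first-order coefficients confirmed to 12 digits (`§3a: M(n* − π²M³/2 + 3M)·π² → 1.0000000000`,
  `§3b: 2M(ψ − (π²M³ − 6M − 1)/2)·π² → 2.0000000000`, `§3c: (N* − βM)π²M/(2/β − 2β) → 1.0000000000`);
  √2 benchmark: `N*² − 2M² → −0.4052847346 = −4/π²`, and its scaled phase distance is bounded below
  (`M·‖φ‖ ≥ 0.1051`, attained along the Pell numbers `M = 169, 985, 5741, 33461, 195025`) — the
  norm obstruction made visible; the OPEN atoms show no floor: best scaled near misses
  `§3a: 0.030 (M = 4063), 0.074 (M = 8755)`, `§3b: 0.16 (M = 9), 0.19 (M = 122605)`,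
  `§3c: 0.30 (M = 23), 0.31 (M = 277)`; counts of `M ≤ 2·10⁵` with `M·‖…‖ < 1 / < 0.1`:
  `10/2, 11/0, 12/0` (heuristic `≈ 2ε·log M`: near misses keep coming; exact hits are a matter of
  transcendence, not of Diophantine approximation).

House rules: sorry-free unless marked NEAR-MISS; axioms standard; every `W` fed to the crux comes
with `IsDefinedOver ⊥` by explicit ℚ-generators and `zariskiDim < 2` by explicit monic integral
relations over `ℂ[u]` (`zariskiDim_le_of_integral_gens`, certificates checked by
`linear_combination`).
-/

set_option linter.dupNamespace false

namespace Summit.Schanuel.Schanuel.Cruxes.SparsityTwo.Disproof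

open Literature.NumberTheory.Transcendental MvPolynomial Complex
open scoped Real

noncomputable section

/-! ## §0 The crux, unfolded -/

/-- The crux is literally "`indepExpPoints W` is finite for every ℚ-defined `W` of dimension `< 2`".
[folklore] -/
theorem sparsityTwo_iff :
    Theses.RigidCore.SparsityTwo ↔
      ∀ W : Set (Fin 2 ⊕ Fin 2 → ℂ), IsDefinedOver (⊥ : Subfield ℂ) W → zariskiDim ℂ W < 2 →
        (indepExpPoints W).Finite :=
  Iff.rfl

/-! ## §1 Load-bearing hypotheses (any proof must use each of them) -/

/-- The crux with "defined over ℚ" weakened to "Zariski closed over ℂ". -/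
def SparsityTwoWithoutDefinedOverQ : Prop :=
  ∀ W : Set (Fin 2 ⊕ Fin 2 → ℂ), IsZariskiClosed ℂ W → zariskiDim ℂ W < 2 →
    (indepExpPoints W).Finite

/-- **False without ℚ-definedness**: the line `{x₂ = 1, y₁ = 1, y₂ = e}` (closed, dim ≤ 1, defined
over ℚ(e)) carries `(2πi(k+1), 1)`, `k ∈ ℕ`. Moral: no field-of-definition-blind method proves the
crux. [folklore] -/
theorem sparsityTwo_false_without_definedOverQ : ¬ SparsityTwoWithoutDefinedOverQ := fun h =>
  infinite_indepExpPoints_expLineE (h _ isZariskiClosed_expLineE zariskiDim_expLineE)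

/-- The crux with the dimension bound dropped. -/
def SparsityTwoWithoutDimBound : Prop :=
  ∀ W : Set (Fin 2 ⊕ Fin 2 → ℂ), IsDefinedOver (⊥ : Subfield ℂ) W → (indepExpPoints W).Finite

/-- **False without the dimension bound** (`W = ℂ⁴`). [folklore] -/
theorem sparsityTwo_false_without_dimBound : ¬ SparsityTwoWithoutDimBound := fun h =>
  infinite_indepExpPoints_univ (h _ isDefinedOver_bot_univ)

/-- The crux with `dim < 2` relaxed to `dim < 3`. -/
def SparsityTwoWithDimLtThree : Prop :=
  ∀ W : Set (Fin 2 ⊕ Fin 2 → ℂ), IsDefinedOver (⊥ : Subfield ℂ) W → zariskiDim ℂ W < 3 →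
    (indepExpPoints W).Finite

/-- **Tight in the dimension**: the ℚ-plane `{x₂ = 1, y₁ = 1}` (dim 2) carries `(2πi(k+1), 1)`.
(Zilber's SEC predicts the same for every free rotund ℚ-surface, e.g. `{y₁ = x₂, y₂ = x₁}` via
fixed points of `exp ∘ exp` — an unconditional witness of that kind needs Hadamard/Rosenbloom,
absent from Mathlib; the degenerate plane suffices to show `< 2` cannot be relaxed.) [folklore] -/
theorem sparsityTwo_false_with_dim_lt_three : ¬ SparsityTwoWithDimLtThree := fun h =>
  infinite_indepExpPoints_expPlaneQ (h _ isDefinedOver_expPlaneQ zariskiDim_expPlaneQ)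

/-- The crux with ℚ-linear independence of `x` weakened to "non-degenerate"
(`x₁ ≠ 0`, `x₂ ≠ 0`, `x₁ ≠ x₂`). -/
def SparsityTwoWithoutLinIndep : Prop :=
  ∀ W : Set (Fin 2 ⊕ Fin 2 → ℂ), IsDefinedOver (⊥ : Subfield ℂ) W → zariskiDim ℂ W < 2 →
    Set.Finite {x : Fin 2 → ℂ | (x 0 ≠ 0 ∧ x 1 ≠ 0 ∧ x 0 ≠ x 1) ∧ Sum.elim x (Complex.exp ∘ x) ∈ W}

/-- **False without ℚ-independence**: the ℚ-line `{y₁ = 1, y₂ = 1, x₂ = 2x₁}` carries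
`(2πi(k+1), 4πi(k+1))`. (Dependent graph points on ℚ-curves occur exactly along rational lines
`q·x = 0`; the route's glue must quotient them out, cf. RigidCore "NOT DECOMPOSED YET".) [folklore] -/
theorem sparsityTwo_false_without_linIndep : ¬ SparsityTwoWithoutLinIndep := fun h =>
  infinite_depExpPoints_expLineDep (h _ isDefinedOver_expLineDep zariskiDim_expLineDep)

/-! ## §2 Calibrations from cycle 1 (wrappers; hypotheses = the crux itself) -/

/-- `SparsityTwo ⇒ e^c ∉ ℚ` for `c ∈ ℚˣ` (ℚ-lines `{x₂ = c, y₁ = 1, y₂ = d}`). [folklore] -/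
theorem sparsityTwo_imp_exp_rat_ne_rat (h : Theses.RigidCore.SparsityTwo) (c d : ℚ) (hc : c ≠ 0) :
    Complex.exp c ≠ d :=
  exp_rat_ne_rat_of_sparsity h c d hc

/-- `SparsityTwo ⇒` real Hermite–Lindemann (`c ∈ ℝ ∩ ℚ̄`, `c ≠ 0 ⇒ e^c ∉ ℚ̄`): any proof of the
crux re-proves `e ∉ ℚ̄`. [folklore] -/
theorem sparsityTwo_imp_hermiteLindemann_real (h : Theses.RigidCore.SparsityTwo) (c : ℝ)
    (hc : c ≠ 0) (halg : IsAlgebraic ℚ (c : ℂ)) : Transcendental ℚ (Complex.exp c) :=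
  transcendental_exp_real_of_sparsity h c hc halg

/-- `SparsityTwo ⇒` finiteness of the common zeros `t ≠ 0` of `(1−t)eᵗ−(1+t)` and
`(1−√2t)e^{√2t}−(1+√2t)` (ℚ-curve `shapiroW`). **Not an open instance** (correction, cycle 2,
after triage r1-1/r1-2): off the strip `|Im t| ≤ 1` all zeros of `(1−t)eᵗ−(1+t)` are purely
imaginary (`σ ↦ σ − ½log(((1+σ)²+θ²)/((1−σ)²+θ²))` has derivative `≥ 1 − 1/|θ|`); on the axis,
`θ − 2arctan θ = 2πK`, `√2θ − 2arctan(√2θ) = 2πL` give with `M = 2K+1`, `N = 2L+1`: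
`N − √2M = −√2/(π²M) + O(M⁻³)`, so the INTEGER `N² − 2M² → −4/π² ∉ ℤ` — finitely many hits
(quadratic slope + torsion phase = Theorem-P class; provable now with `irrational_pi_sq`-level
input). Kept as a decidable benchmark. [folklore] -/
theorem sparsityTwo_imp_shapiroModel_finite (h : Theses.RigidCore.SparsityTwo) :
    Set.Finite {t : ℂ | t ≠ 0 ∧ (1 - t) * Complex.exp t = 1 + t ∧
      (1 - (Real.sqrt 2 : ℂ) * t) * Complex.exp ((Real.sqrt 2 : ℂ) * t) =
        1 + (Real.sqrt 2 : ℂ) * t} :=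
  shapiroModel_finite_of_sparsity h

/-! ## §3 Cycle 2: open calibration atoms

### §3a The root-chain curve `{x₂ = x₁³, y₂ = 1, (1 − x₁)(y₁ + 1) = 2}`
Hits: `t³ = 2πin`, `n ≠ 0`, and `eᵗ = (1+t)/(1−t)`. The two non-imaginary cube roots have
`|Re t| = (2π|n|)^{1/3}cos(π/6) → ∞` against `|(1+t)/(1−t)| → 1`: finitely many. The imaginary root
`t = iθ`, `θ = ∓(2π|n|)^{1/3}`, hits iff `θ − 2arctan θ ∈ 2πℤ`; writing `θ = πM − 2/θ + O(θ⁻³)`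
(`M` odd) this is `n = ∓(π²M³/2 − 3M + 1/(π²M) + O(M⁻³))`, i.e. `‖π²M³/2 + 1/(π²M) + …‖ = 0`:
first-order coefficient `1/π² ≠ 0` (depth 1; numerically `M·(n − π²M³/2 + 3M)·π² = 0.99986, 1.00001`
at `K = 10, 100`). -/

/-- **`SparsityTwo` settles the root-chain atom** (curve `rootChainW`, certificates and proof in
`ExpPointsCubicAtoms.lean`): the crux implies that `eᵗ = (1 + t)/(1 − t)` has only finitely many
solutions `t` with `t³ ∈ 2πiℤ ∖ {0}` — equivalently, finitely many odd `M` with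
`‖π²M³/2 + 1/(π²M) + O(M⁻³)‖ = 0` exactly (§3a). OPEN: each hit violates SC(2); no unconditional
method known (depth-1 non-linear cusp / Puiseux-twist chain: outside modulus splitting, Baker,
Galois-norm, Liouville–Roth depth sieves, and finite-type heights). The simplest open instance of
the crux known to this file. [folklore] -/
theorem sparsityTwo_imp_rootChain_finite (h : Theses.RigidCore.SparsityTwo) :
    Set.Finite {t : ℂ | t ≠ 0 ∧ Complex.exp (t ^ 3) = 1 ∧ (1 - t) * Complex.exp t = 1 + t} :=
  rootChain_finite_of_sparsity h

/-! ### §3b The double-Cayley cubic curve `{x₂ = x₁³, (1−x₁)(y₁+1) = 2, (1−x₂)(y₂+1) = 2}`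
One component, four punctures (`x₁ = ∞, 1, ω, ω²`), so every coordinate is integral of degree 4
over `ℂ[x₁ + y₁ + y₂]`. Hits: common zeros of `F(t) = (1−t)eᵗ − (1+t)` and
`F(t³) = (1−t³)e^{t³} − (1+t³)`. Off the strip `|Im t| ≤ 1` the zeros of `F` are purely imaginary,
`t = iθ_K`, `θ_K = πM − 2/θ_K + O(θ_K⁻³)` (`M = 2K+1`); then `t³ = −iθ_K³` is again on the axis and
`F(t³) = 0` iff `θ_K³ − 2arctan θ_K³ ∈ 2πℤ`, i.e. (expanding `θ_K³ = M³π³ − 6Mπ + 2/(Mπ) + O(M⁻³)`)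
`‖π²M³/2 − 1/2 + 1/(π²M) + O(M⁻³)‖ = 0` — "two inexact chains with a non-linear end": a depth-1
Weyl-cubic target for `π²` (numerically `c·π² → 2.0002, 2.00002` at `K = 10, 100` for the
coefficient `c/(2M)`). Not an exponential-polynomial pair in Ritt's sense (frequency `t³`), so even
Shapiro's conjecture does not cover it; SC(2) does (`trdeg ℚ(t, t³, eᵗ, e^{t³}) = trdeg ℚ(t) ≤ 1`).
-/

/-- **`SparsityTwo` settles the double-Cayley cubic atom** (curve `cubicW`,
`ExpPointsCubicAtoms.lean`): the crux implies that `(1−t)eᵗ = 1+t` and `(1−t³)e^{t³} = 1+t³` have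
only finitely many common solutions `t ≠ 0` (exact hits `‖π²M³/2 − 1/2 + 1/(π²M) + O(M⁻³)‖ = 0`,
`M` odd). OPEN; each hit violates SC(2); outside Shapiro's conjecture (non-linear frequency).
[folklore] -/
theorem sparsityTwo_imp_cubicCayley_finite (h : Theses.RigidCore.SparsityTwo) :
    Set.Finite {t : ℂ | t ≠ 0 ∧ (1 - t) * Complex.exp t = 1 + t ∧
      (1 - t ^ 3) * Complex.exp (t ^ 3) = 1 + t ^ 3} :=
  cubicCayley_finite_of_sparsity h

/-! ### §3c The slope-∛2 double-Cayley curve `{x₂³ = 2x₁³, (1−x₁)(y₁+1) = 2, (1−x₂)(y₂+1) = 2}`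
The honest open analogue of `shapiroW` (triage r1-2): a LINEAR irrational slope of degree 3 with
torsion phase. Over ℂ it has three components `x₂ = ζ∛2·x₁`; on the complex ones `Re x₂ → ∓∞` along
the hits of the first factor (`x₁ ≈ iπM`) while `|y₂| → 1`, so they carry finitely many hits; on the
real one, `x₁ = iθ`, `θ − 2arctan θ = 2πK` and `βθ − 2arctan(βθ) = 2πL` (`β = ∛2`) give, with
`M = 2K+1`, `N = 2L+1`, `N − βM = (2/β − 2β)/(π²M) + O(M⁻³) = (∛4 − 2∛2)/(π²M) + …` — non-zero
first-order term (depth 1) and NO norm obstruction: `N³ − 2M³ = (N − βM)(N² + βMN + β²M²) ≈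
3β²(2/β − 2β)M/π² → ∞` is an unbounded integer, unlike the bounded `N² − 2M² → −4/π²` of the √2 case.
This is the `Sim(β, ℚ(β)·π⁻²)` atom of cards galois-norm-branch-defect / resonance-depth-roth-sieve.
Dimension: three components × three punctures = degree-9 integral relations over
`ℂ[x₁ + x₂ + y₁ + y₂ + 2]`, obtained WITHOUT factoring via the cubic-resultant identity
`a₀³ + c·a₁³ + c²·a₂³ − 3c·a₀a₁a₂ = (a₀ + a₁T + a₂T²)(…) − (T³ − c)(…)`. -/

/-- **`SparsityTwo` settles the slope-∛2 Cayley atom** (curve `cbrtW`, `ExpPointsCbrtTwoModel.lean`;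
the `Sim(∛2, ℚ(∛2)·π⁻²)` atom): for real `β` with `β³ = 2`, the crux implies that
`(1−t)eᵗ = 1+t` and `(1−βt)e^{βt} = 1+βt` have only finitely many common solutions `t ≠ 0`
(exact hits `N − βM = (2/β − 2β)/(π²M) + O(M⁻³)`, `M, N` odd). OPEN: depth 1 with
`[ℚ(β):ℚ] = 3`, outside the Galois-norm (`d = 2`) and Liouville (depth `≥ 3`) ranges; a non-simple
case of Shapiro's conjecture, known only under SC (D'Aquino–Macintyre–Terzo 2014 §5). [folklore] -/
theorem sparsityTwo_imp_cbrtTwoCayley_finite (h : Theses.RigidCore.SparsityTwo) (β : ℝ)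
    (hβ : β ^ 3 = 2) :
    Set.Finite {t : ℂ | t ≠ 0 ∧ (1 - t) * Complex.exp t = 1 + t ∧
      (1 - (β : ℂ) * t) * Complex.exp ((β : ℂ) * t) = 1 + (β : ℂ) * t} :=
  cbrtTwoCayley_finite_of_sparsity h β hβ

/-! ## §4 Why the crux resists (for ideators / provers) -/

/-- WHY IT RESISTS — summary for provers (no content; read the docstring).
1. No unconditional kill exists: `SparsityTwo` is a theorem of SC(2) (§5, kernel-checked); its
   emptiness version IS SC(2) (§6); the counted objects are exactly the SC(2) counterexamples.
2. Any proof must consume ℚ-DEFINEDNESS (§1: closed + dim ≤ 1 over ℚ(e) fails), the DIMENSION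
   bound (tight at 2) and ℚ-INDEPENDENCE (rational lines carry lattices of dependent points).
3. Any proof re-proves real Hermite–Lindemann (§2) and decides explicit open coincidence problems
   (§3): along every Γ-symmetric ℚ-curve with a unitary cusp the hits are governed by an exact
   Diophantine condition at the Dirichlet scale — `‖βM + c/M + …‖ = 0` (linear slope β of degree
   ≥ 3 or non-torsion phase), `‖π²M³/2 + c/M + …‖ = 0` (root chains / non-linear ends) — whose
   finiteness is open; heuristically the near-miss counts diverge like `log X`, so finiteness is a
   statement about EXACT hits, i.e. transcendence, not Diophantine approximation.
4. Decidable sub-classes (do not calibrate): finite y-projection (Baker, supports 0974/0975),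
   non-symmetric curves (modulus splitting), quadratic slope + torsion phase (Galois norm, §2
   correction), exact lattice chains with monomial/polynomial twist (heights, card
   function-field-heights-finite-type), balanced cusps of depth ≥ deg β (Liouville). [folklore] -/
theorem resists : True := trivial

/-! ## §5 Upper calibration: the crux is a theorem of SC(2) (kernel-checked)
Landed as `TrdegZariskiDim.lean` (p72297): `trdeg_adjoin_lt_of_mem_of_zariskiDim_lt` — a point of a
ℚ-variety `W` with `zariskiDim ℂ W < d` has `trdeg_ℚ ℚ(P) < d` (maximal independent coordinates
`P|_S`; `ℚ(P)` embedded into an algebraic closure of `ℂ(t_S)` with `P|_S ↦ t_S` by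
`IsFractionRing.lift` + `IsAlgClosed.lift`; the image is an `Ω`-point of `W` with
`trdeg_ℂ ≥ #S`, and `zariskiDim Z(ker aeval) = trdeg_ℂ` by `zariskiDim_zeroLocus_ker`). -/

/-- `SchanuelRank 2 ⇒ SparsityTwo` (indeed the counted set is empty). [folklore] -/
theorem sparsityTwo_of_schanuelRank_two (h : SchanuelRank 2) : Theses.RigidCore.SparsityTwo :=
  fun W hW hd => sparsity_of_schanuelRank_two h W hW hd

/-- **The crux is a theorem of the summit**: `Schanuel ⇒ SparsityTwo`. [folklore] -/
theorem sparsityTwo_of_schanuel (h : _root_.Schanuel) : Theses.RigidCore.SparsityTwo :=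
  sparsityTwo_of_schanuelRank_two fun y hy => h 2 y hy

/-- Under Schanuel the counted set is EMPTY (the crux only asks for finiteness; formally weaker).
[folklore] -/
theorem indepExpPoints_eq_empty_of_schanuel (h : _root_.Schanuel) {W : Set (Fin 2 ⊕ Fin 2 → ℂ)}
    (hW : IsDefinedOver (⊥ : Subfield ℂ) W) (hd : zariskiDim ℂ W < 2) : indepExpPoints W = ∅ :=
  indepExpPoints_eq_empty_of_schanuelRank_two (fun y hy => h 2 y hy) hW hd

/-- **For refuters**: a refutation of the crux refutes Schanuel's conjecture itself (so none is to
be expected; the standing adversary's output is §1–§3). [folklore] -/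
theorem not_schanuel_of_not_sparsityTwo (h : ¬ Theses.RigidCore.SparsityTwo) : ¬ _root_.Schanuel :=
  fun hS => h (sparsityTwo_of_schanuel hS)

/-! ## §6 SC(2) in the language of the crux (kernel-checked, `TrdegZariskiDimConverse.lean` p72508)
Converse of §5: every `P ∈ ℂ^ι` lies on a ℚ-variety of `zariskiDim ≤ trdeg_ℚ ℚ(P)` (Noether
normalisation of `ℚ[P]` + `zariskiDim_le_of_integral_gens`). Consequences below: the EMPTINESS
version of the crux is SC(2) verbatim, and the objects the crux counts are precisely the would-be
SC(2) counterexamples. In particular no "cheap" strengthening of the crux to emptiness is available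
(it is the summit slice itself), and no weakening of SC(2) is hidden in the crux beyond
"finite instead of empty, curve by curve". -/

/-- **SC(2) ⟺ emptiness version of the crux.** [folklore] -/
theorem schanuelRank_two_iff_emptiness :
    SchanuelRank 2 ↔ ∀ W : Set (Fin 2 ⊕ Fin 2 → ℂ), IsDefinedOver (⊥ : Subfield ℂ) W →
      zariskiDim ℂ W < 2 → indepExpPoints W = ∅ :=
  schanuelRank_two_iff_indepExpPoints_eq_empty

/-- **Every would-be SC(2) counterexample is counted by the crux**: a ℚ-independent `x` with
`trdeg_ℚ ℚ(x, eˣ) < 2` lies in `indepExpPoints W` for some ℚ-defined `W` with `zariskiDim ℂ W < 2`.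
[folklore] -/
theorem counterexample_mem_indepExpPoints {x : Fin 2 → ℂ} (hx : LinearIndependent ℚ x)
    (h : Algebra.trdeg ℚ ↥(IntermediateField.adjoin ℚ (Set.range x ∪ Set.range (cexp ∘ x))) < 2) :
    ∃ W : Set (Fin 2 ⊕ Fin 2 → ℂ), IsDefinedOver (⊥ : Subfield ℂ) W ∧ zariskiDim ℂ W < 2 ∧
      x ∈ indepExpPoints W :=
  exists_mem_indepExpPoints_of_trdeg_lt_two hx h

/-- Hence **`SparsityTwo` says: every ℚ-curve carries only finitely many SC(2) counterexamples**
(restatement; the set of counterexamples ON `W` is `indepExpPoints W` minus nothing, by §5/§6).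
[folklore] -/
theorem sparsityTwo_iff_finitely_many_counterexamples_per_curve :
    Theses.RigidCore.SparsityTwo ↔ ∀ W : Set (Fin 2 ⊕ Fin 2 → ℂ), IsDefinedOver (⊥ : Subfield ℂ) W →
      zariskiDim ℂ W < 2 → Set.Finite {x : Fin 2 → ℂ | LinearIndependent ℚ x ∧
        Algebra.trdeg ℚ ↥(IntermediateField.adjoin ℚ (Set.range x ∪ Set.range (cexp ∘ x))) < 2 ∧
        Sum.elim x (cexp ∘ x) ∈ W} := by
  constructor
  · intro h W hW hd
    exact (h W hW hd).subset fun x hx => ⟨hx.1, hx.2.2⟩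
  · intro h W hW hd
    refine (h W hW hd).subset fun x hx => ⟨hx.1, ?_, hx.2⟩
    have := trdeg_adjoin_lt_of_mem_of_zariskiDim_lt (d := 2) hW hx.2 (by exact_mod_cast hd)
    rw [Set.Sum.elim_range] at this
    exact_mod_cast this

/-! ### §6b The finiteness/emptiness gap is real: ℚ-lines where the crux is trivial and SC(2) is open
On the ℚ-line `L_{a,b} = {x₁ = 1, y₁ = x₂, y₂ = a·x₂ + b}` (`a, b ∈ ℚ`) a graph point has `x₂ = e`,
so `indepExpPoints L_{a,b} ⊆ {(1, e)}`: the crux holds there FOR FREE, while emptiness says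
`e^e ≠ a·e + b` — for `(a, b) = (0, q)` over all `q ∈ ℚ` this is the IRRATIONALITY OF `e^e`, open.
So `SparsityTwo` is strictly weaker than SC(2) curve by curve in a way no cheap argument closes. -/

/-- The ℚ-line `L_{a,b} = {x₁ = 1, y₁ = x₂, y₂ = a·x₂ + b}`. [folklore] -/
def eTowerLine (a b : ℚ) : Set (Fin 2 ⊕ Fin 2 → ℂ) :=
  {w | w (Sum.inl 0) = 1 ∧ w (Sum.inr 0) = w (Sum.inl 1) ∧ w (Sum.inr 1) = a * w (Sum.inl 1) + b}

/-- `eTowerLine a b` is defined over the prime field. [folklore] -/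
theorem isDefinedOver_eTowerLine (a b : ℚ) : IsDefinedOver (⊥ : Subfield ℂ) (eTowerLine a b) := by
  refine isDefinedOver_bot_of_forall_iff (eTowerLine a b)
    {X (Sum.inl 0) - 1, X (Sum.inr 0) - X (Sum.inl 1),
      X (Sum.inr 1) - C (a : (⊥ : Subfield ℂ)) * X (Sum.inl 1) - C (b : (⊥ : Subfield ℂ))} fun w => ?_
  simp only [eTowerLine, Set.mem_setOf_eq, Set.mem_insert_iff, Set.mem_singleton_iff,
    forall_eq_or_imp, forall_eq, map_sub, map_mul, aeval_X, aeval_C, map_one, sub_eq_zero]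
  have ha : algebraMap (⊥ : Subfield ℂ) ℂ (a : (⊥ : Subfield ℂ)) = (a : ℂ) := by rw [map_ratCast]
  have hb : algebraMap (⊥ : Subfield ℂ) ℂ (b : (⊥ : Subfield ℂ)) = (b : ℂ) := by rw [map_ratCast]
  rw [ha, hb]
  constructor <;> rintro ⟨h1, h2, h3⟩ <;> exact ⟨h1, h2, by linear_combination h3⟩

/-- `eTowerLine a b` has dimension `≤ 1 < 2` (all coordinates are polynomials in `x₂`). [folklore] -/
theorem zariskiDim_eTowerLine (a b : ℚ) : zariskiDim ℂ (eTowerLine a b) < 2 := by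
  refine lt_of_le_of_lt ?_ (lt_of_eq_of_lt (ringKrullDim_mvPolynomial_fin_complex 1)
    one_lt_two_withBot)
  refine zariskiDim_le_of_coord_polys (eTowerLine a b) (fun _ : Fin 1 => Sum.inl 1) ?_
  rintro (i | i) <;> fin_cases i
  · exact ⟨C 1, fun w hw => by simpa using hw.1⟩
  · exact ⟨X 0, fun w _ => by simp⟩
  · exact ⟨X 0, fun w hw => by simpa using hw.2.1⟩
  · exact ⟨C (a : ℂ) * X 0 + C (b : ℂ), fun w hw => by simpa using hw.2.2⟩

/-- On `L_{a,b}` the only candidate is `(1, e)`: **the crux holds there for free.** [folklore] -/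
theorem indepExpPoints_eTowerLine_subset (a b : ℚ) :
    indepExpPoints (eTowerLine a b) ⊆ {![1, cexp 1]} := by
  rintro x ⟨-, h1, h2, -⟩
  simp only [Sum.elim_inl, Sum.elim_inr, Function.comp_apply] at h1 h2
  refine Set.mem_singleton_iff.mpr (funext fun i => ?_)
  fin_cases i
  · simpa using h1
  · simp only [Fin.mk_one, Matrix.cons_val_one, Matrix.cons_val_fin_one]
    rw [← h2, h1]

/-- Hence `indepExpPoints (eTowerLine a b)` is finite, unconditionally and trivially. [folklore] -/
theorem indepExpPoints_eTowerLine_finite (a b : ℚ) : (indepExpPoints (eTowerLine a b)).Finite :=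
  (Set.finite_singleton _).subset (indepExpPoints_eTowerLine_subset a b)

/-- … while **emptiness on `L_{a,b}` is `e^e ≠ a·e + b`** (for `a = 0` and all `b ∈ ℚ`: the
irrationality of `e^e`, OPEN). The `←` direction uses nothing; `→` uses `e ∉ ℚ`
(Hermite–Lindemann in the tree, `transcendental_exp_holds`). [folklore] -/
theorem indepExpPoints_eTowerLine_eq_empty_iff (a b : ℚ) :
    indepExpPoints (eTowerLine a b) = ∅ ↔ cexp (cexp 1) ≠ a * cexp 1 + b := by
  constructor
  · intro h heq
    have hmem : (![1, cexp 1] : Fin 2 → ℂ) ∈ indepExpPoints (eTowerLine a b) := by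
      refine ⟨?_, by simp, by simp, by simpa using heq⟩
      rw [LinearIndependent.pair_iff]
      intro s t hst
      rw [Rat.smul_def, Rat.smul_def] at hst
      simp only [mul_one] at hst
      by_cases ht : t = 0
      · subst ht
        simp only [Rat.cast_zero, zero_mul, add_zero, Rat.cast_eq_zero] at hst
        exact ⟨hst, rfl⟩
      · exfalso
        have ht' : (t : ℂ) ≠ 0 := by exact_mod_cast ht
        have he : cexp 1 = ((-s / t : ℚ) : ℂ) := by
          push_cast
          field_simp
          linear_combination hst
        have halg : IsAlgebraic ℚ (cexp 1) := by rw [he]; exact isAlgebraic_algebraMap _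
        exact transcendental_exp_holds isAlgebraic_one one_ne_zero halg
    rw [h] at hmem
    exact hmem
  · intro h
    ext x
    simp only [Set.mem_empty_iff_false, iff_false]
    intro hx
    have := indepExpPoints_eTowerLine_subset a b hx
    rw [Set.mem_singleton_iff] at this
    subst this
    obtain ⟨-, -, -, h3⟩ := hx
    exact h (by simpa [eTowerLine] using h3)

/-! ## -- Targets (line `cusp-germ-schneider-sparsity`, PICKED 2026-08-16; stubs E, H, R, Im, S, ★)
VERDICT PER STUB (cheap arsenal; details in the docstrings below):
* `stub_cuspEscape` (E), `stub_classicalClassesFinite` (H), `stub_realArithmeticCuspFinite` (★): each is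
  a THEOREM OF SC(2) for trivial reasons — (E) has the hypothesis `(indepExpPoints W).Infinite`, (H) and (★)
  conclude finiteness of SUBSETS of `indepExpPoints W` (for (★): the ray hits are indexed by `N` with
  `x N ∈ indepExpPoints W`, and `N ↦ x N` is finite-to-one since `‖x N‖ ≥ 2πN − O(1)`), and under SC(2)
  `indepExpPoints W = ∅` (§5). Hence NONE of them can be refuted without refuting Schanuel
  (`wStubs_of_schanuelRank_two` below) — exactly like the crux. (H) was moreover re-derived: part (1) by
  "curve components inside a section are ℚ̄-components, `e^c ∈ ℚ̄` forces `c = 0` (H–L), then hits are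
  dependent"; part (2) by the coefficientwise descent `a_γ + b_γu₁ + c_γu₂ = 2πi s_γ` with `a_γ ∈ ℚ̄`,
  `b, c, s ∈ ℚ` — the constant `a_γ` is killed by H–L ALONE (it is a logarithm of an algebraic number up
  to an integer multiple), so Baker is indeed not needed: no objection.
* `stub_rationalJetRunge` (R), `stub_nonRealJetFinite` (Im): landed (p72001, p72083) — nothing to attack.
* `stub_cuspZeroLogDensity` (S): the only SC-INDEPENDENT open stub (pure analysis, no `W`), hence the only
  one a counterexample could kill. Could not break it. TIGHTNESS beyond the card's Pell conic: for `e = 2`,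
  `A = w`, the ALGEBRAIC tail `g(z) = (√(1−z²) − 1)/z = −z/(1 + √(1−z²))` gives
  `A(√N) + g(1/√N) = √(N−1)`, an integer at every `N = m² + 1` — POWER density `≍ √X` of hits; so the
  transcendence hypothesis separates `√X` from `o(log X)` with nothing in between claimed. WHY A
  TRANSCENDENTAL COUNTEREXAMPLE IS IMPLAUSIBLE (heuristic, recorded for the prover of S): along hits the
  values `g(N^{-1/e}) = L_N − A(N^{1/e})` are forced; interpolating forced data at geometrically growing
  `N_n ≈ Cⁿ` (positive log-density) by a convergent power series needs the stage-`n` defect to be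
  `≲ C^{−n²/2}` (size of the Newton denominators `∏_{j<n}|z_n − z_j|`), while choosing `N_n` in a range of
  length `Cⁿ` only buys `≈ C^{−n}` (Dirichlet); the affordable growth is `log N_{n+1} ≍ Σ_{j≤n} log N_j`,
  i.e. `≍ log log X` hits (the planner's Newton-series remark) — consistent with S. Liouville-type slopes
  `β` do not help (their convergents are super-lacunary: again `≍ log log X`). The constants of the
  Schneider count remain the prover's risk (triage: hand-over exponent `0.19D`; redo for `e = 2, d = 3`).
* Nothing in the line contradicts §1–§3: the field-blind stubs (E, R, Im, S) never assert finiteness of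
  independent hits; ℚ-definedness is consumed in (H) and (★)(a); the three open atoms of §3 all land in (★)
  (root chain: real non-rational jet `A(w) = −(2π)^{−2/3}w − 1/2`, `e = 3`, as the lead checked). -/

/-- **The `W`-quantified stubs of the picked line are theorems of SC(2)** (so the disprover cannot kill
them): under `SchanuelRank 2`, for every ℚ-defined `W` with `zariskiDim ℂ W < 2`, `indepExpPoints W` is not
infinite (kills the hypothesis of `stub_cuspEscape`) and every subset of it is finite (gives the conclusions
of `stub_classicalClassesFinite` and, the ray hits being indexed finite-to-one by points of
`indepExpPoints W`, of `stub_realArithmeticCuspFinite`). [folklore] -/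
theorem wStubs_of_schanuelRank_two (hSC : SchanuelRank 2) (W : Set (Fin 2 ⊕ Fin 2 → ℂ))
    (hW : IsDefinedOver (⊥ : Subfield ℂ) W) (hd : zariskiDim ℂ W < 2) :
    ¬ (indepExpPoints W).Infinite ∧ ∀ S : Set (Fin 2 → ℂ), S ⊆ indepExpPoints W → S.Finite := by
  have h0 : indepExpPoints W = ∅ := indepExpPoints_eq_empty_of_schanuelRank_two hSC hW hd
  refine ⟨fun h => h (by rw [h0]; exact Set.finite_empty), fun S hS => ?_⟩
  rw [h0, Set.subset_empty_iff] at hS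
  rw [hS]
  exact Set.finite_empty

/-! ## §7 Reductions any proof may use (kernel-checked, `ExpPointsPrimeReduction.lean` p72569) -/

/-- **WLOG `W` is ℚ-irreducible**: the crux is equivalent to its restriction to `W = Z(𝔮)` for
PRIME ideals `𝔮 ⊆ ℚ[x₁, x₂, y₁, y₂]` (finite union over the minimal primes of the defining ideal).
[folklore] -/
theorem sparsityTwo_iff_prime :
    Theses.RigidCore.SparsityTwo ↔
      ∀ q : Ideal (MvPolynomial (Fin 2 ⊕ Fin 2) (⊥ : Subfield ℂ)), q.IsPrime →
        zariskiDim ℂ (zeroLocus ℂ q) < 2 → (indepExpPoints (zeroLocus ℂ q)).Finite :=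
  sparsity_iff_prime

/-! ## §8 Attempted refutation of the route's pending glue lemma — it is TRUE (note for the planner)
RigidCore "NOT DECOMPOSED YET" lists the uniformity lemma turning `SparsityTwo` into (S*) at
`n = 2`: *the ℚ-DEPENDENT non-zero exponential points of a ℚ-variety `W` of dimension `< 2` lie on
finitely many rational lines `a x₁ + b x₂ = 0`*. The disprover tried to break it and instead found
a proof from landed material (§5–§7 + Hermite–Lindemann `transcendental_exp_holds`):
WLOG `W = Z(𝔮)` ℚ-irreducible (§7). A dependent `x ≠ 0` lies on a unique primitive direction
`(a, b) ∈ ℤ²`, `x = t(−b, a)`, `t ≠ 0`, and then `(x, eˣ) ∈ V_{a,b} := {a x₁ + b x₂ = 0,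
y₁^{a⁺} y₂^{b⁺} = y₁^{a⁻} y₂^{b⁻}}`, a ℚ-surface. If `W ⊄ V_{a,b}` then `W ∩ V_{a,b}` is a proper
ℚ-closed subset of the ℚ-irreducible curve `W`, hence of dimension `0`, so its points have
`trdeg_ℚ < 1` (§5 with `d = 1`), i.e. are ALGEBRAIC; but `x = t(−b, a)` algebraic with `t ≠ 0`
makes `e^{at}` or `e^{−bt}` algebraic with a non-zero algebraic exponent — Hermite–Lindemann. So a
direction carrying a dependent point forces `W ⊆ V_{a,b} ⊆ {a x₁ + b x₂ = 0}`; two distinct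
directions force `W ⊆ {x = 0}` (no `x ≠ 0` at all). Hence: AT MOST ONE direction per ℚ-irreducible
component, `≤ #minimal primes` in general. (Formal cost ≈ 400 lines: the only piece not yet in the
tree is "proper ℚ-closed subset of a ℚ-irreducible curve has `zariskiDim < 1`", i.e. the two-field
Nullstellensatz `I_⊥(Z_ℂ(𝔮)) = 𝔮` plus `ringKrullDim_quotient_add_one_le`, or an embedding
`Frac(ℚ[X]/𝔮) ↪ ℂ`.) This is a SUPPORT statement for the planner to file; it is not the crux. -/

/-- Planner note (no content): the uniformity lemma at `n = 2` is provable now; see the section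
docstring above for the proof. [folklore] -/
theorem uniformity_two_is_provable_note : True := trivial


/-! ## §9 Cycle 3 (g3, 2026-08-16): stub S (`stub_cuspZeroLogDensity`) — sharp, rigid, and not killable

Stub S: for `e ≥ 1`, `A ∈ ℂ[w]`, `g` analytic at `0` with `g 0 = 0` and TRANSCENDENTAL over `ℂ(z)`, the hit
set `H = {N : A(N^{1/e}) + g(N^{-1/e}) ∈ ℤ}` has zero LOWER logarithmic density:
`∀ ε > 0, ∃ᶠ X, #(H ∩ [0, X]) ≤ ε log X`. It is the only open stub of the picked line that a counterexample
could kill (E, H, ★ are theorems of SC(2): `wStubs_of_schanuelRank_two`, drefute-g2 `StubsUnderSC.lean`).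
Verdict of this cycle: NOT KILLABLE — evidence below, §9a kernel-checked.

### §9a SHARPNESS (Lean, end of this section; Literature twin `GoldenGermLogDensity.lean`, p75095)
With `e = 1`, the irrational real jet `A = φ·X` and the ALGEBRAIC tail
`goldenGerm σ = (√(5 + 4σ²) − √5)/(2σ)` (`σg² + √5·g − σ = 0`), every `F₂ₙ` is a hit
(`φF₂ₙ + g(1/F₂ₙ) = F₂ₙ₊₁`, Binet) and `F₂ₙ ≤ 3ⁿ`, so `#(H ∩ [0,X]) ≥ ⌊log₃ X⌋ > log X/(2 log 3)` for
`X ≥ 9` (`eventually_log_lt_card_goldenHits`), and S's conclusion FAILS for this `(e, A, g)`: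
`stubS_false_without_transcendence` — S with its transcendence hypothesis deleted (all other binders
verbatim) is false, witnessed by a NON-ZERO tail with an IRRATIONAL jet (drefute-g0's
`cuspZeroLogDensity_false_without_transc` used `g = 0`, which Runge (R) already explains). So S separates
`≥ log X/(2 log 3)` (algebraic, attained) from `o(log X)` infinitely often (transcendental, claimed): the
hypothesis is razor-necessary and the `log X` scale cannot be lowered on the algebraic side.

### §9b EXACT EXISTENCE CRITERION (what a counterexample must achieve)
Fix hits `N₀ < N₁ < ⋯` and integers `M_i`; put `z_i = N_i^{-1/e}`, `y_i = M_i − A(N_i^{1/e})`. An analytic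
tail through the data exists iff the divided differences obey `|y[z₀,…,z_k]| ≤ C^k` (Newton series at
nodes accumulating at `0` ⟺ analyticity), and it is then UNIQUE (identity theorem): the free parameters are
`(N_i)`, `(M_i)`, `A` only. Equivalently `M_k` must be predicted by the Lagrange interpolant of the earlier
data to within `≈ C^{-k²/(2e)}`, while choosing `N_k ≤ C^k` and `M_k ∈ ℤ` buys only `≈ C^{-k}` (pigeonhole
on `{αN}`): unstructured constructions reach `≍ log log X` hits, never `≍ log X` (cycle-2 heuristic;
drefute-g2 (a), (b)). A `log X`-dense transcendental tail needs ARITHMETIC structure — and the structure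
behind every algebraic example is rigid:

### §9c LUCAS-ABSCISSA RIGIDITY (new; paper proof, not yet formalised)
**Theorem.** Let `θ > 1` be a real quadratic unit of norm `1` (`L_j := θ^j + θ^{-j} ∈ ℤ`) and
`N(u) ∈ ℚ(θ)[u, u⁻¹]` a Laurent polynomial with `N_m := N(θ^{-m}) ∈ ℕ` for `m ≥ m₀` (every Pell/Lucas-type
sequence: `F₂ₘ = (θ^m − θ^{-m})/√5` with `θ = φ²`; the Pell `N` with `2N² + 1 = □`; …). Let
`h(N) = A(N^{1/e}) + g(N^{-1/e})`, `e ≥ 1`, ANY jet `A ∈ ℂ[w]`, ANY tail `g` analytic at `0`. If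
`S := {m : h(N_m) ∈ ℤ}` has POSITIVE UPPER DENSITY then `g` is algebraic (on each residue class of `m`
mod `e`, `h(N_m)` is a Laurent polynomial in `θ^{m/e}`).
*Proof.* On a class `m ≡ r (e)` of positive upper density put `v = θ^{-m/e}`: `N^{±1/e}` are Laurent /
power series in `v`, so `F(v) := h(N) = Σ_{k ≥ −D} c_k v^k` is meromorphic at `0` (`D = J·deg A`, `J` the
pole order of `N(u)`), with nodes `v = v₀q^{m'}`, `q = θ^{-1}`. For `p ≥ 1` let
`Λ(T) := (T − 1)·∏_{k=1}^{D} (T² − L_{pk}T + 1) = Σ_r λ_r T^r ∈ ℤ[T]`. For every `(2D+2)`-term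
arithmetic progression `m', m'+p, …, m'+(2D+1)p` of class indices in `S`,
`Ξ(v) := Σ_r λ_r F(v·q^{pr}) = Σ_k c_k Λ(q^{pk}) v^k` takes an INTEGER value at `v = v₀q^{m'}`; and
`Λ(q^{pk}) = 0` exactly for `|k| ≤ D`, so `Ξ` is analytic at `0` with `Ξ(0) = 0`. A set of positive upper
density contains infinitely many `(2D+2)`-APs with ONE common difference `p` (SZEMERÉDI: a `k`-AP inside a
window of length `(k−1)P + 1` has difference `≤ P`, so "no `k`-AP of difference `≤ P` beyond `X_P`" caps the
window density by `r_k((k−1)P+1)/((k−1)P+1) → 0`; for a FULL class or sub-progression nothing is needed).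
Along them `Ξ(v₀q^{m'_j}) ∈ ℤ` and `→ Ξ(0) = 0`, hence `= 0` for large `j`; the nodes accumulate at `0`,
so `Ξ ≡ 0`, i.e. `c_k = 0` for all `k > D`: `F` is a Laurent polynomial in `v`, and `v` is algebraic over
`ℂ(N)`. ∎
**Consequences.** (i) The hit set of a TRANSCENDENTAL tail meets every Lucas sequence `(N_m)` in an index
set of upper density `0`, i.e. in a set of ZERO upper logarithmic density: no counterexample to S re-uses
Pell/Lucas abscissae with new integer ordinates on any positive proportion of them (this closes the gap in
drefute-g2 (c), whose identity-theorem argument needs the ORDINATES to be the Pell ones). (ii) For a full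
class this is a Pólya–Gelfond-type rigidity with a ten-line proof (Lucas second differences), and for
`(e, deg A) = (1, 1)` it reads: `h` analytic at `∞` with a simple pole and `h(F₂ₘ) ∈ ℤ` for all large `m`
⇒ `h(F₂ₘ) = aθ^m + b + cθ^{-m}`. (iii) It does not prove S: hits need not be Lucas numbers, and countably
many density-zero families may add up to positive log-density. (iv) GEOMETRIC abscissae `N_m = P(bᵐ)`
(`b ≥ 2`, `P` an integer-valued Laurent polynomial) are covered by the same proof with
`Λ(T) = (T − 1)∏_{k=1}^{D}(T − b^{pk}) ∈ ℤ[T]` (integer roots; `Λ(b^{-pk}) ≠ 0` for `k ≥ 1`, so here even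
`c_k = 0` for ALL `k ≥ 1`: `h(P(bᵐ))` is a polynomial in `bᵐ`); the case `P = λ·X`, `deg A = 1`,
3-term progressions, is KERNEL-CHECKED in §9c′ below
(`stubS_hits_rigid_on_geometric`, Literature `GeometricHitRigidity.lean`, p75707). (iv′) The GOLDEN/LUCAS case itself with a linear jet is KERNEL-CHECKED as well (Literature
`GoldenHitRigidity.lean`, p75995, theorem `golden_rigidity`; not inlined here to keep this file
readable): infinitely many Fibonacci 4-progressions `F₂ₘ, F₂₍ₘ₊ₚ₎, F₂₍ₘ₊₂ₚ₎, F₂₍ₘ₊₃ₚ₎` of hits of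
`αN + α₀ + g(1/N)` (any `α, α₀ ∈ ℂ`, any analytic `g` with `g 0 = 0`) force `g(z(u)) = κ·u` near `0`,
`z(u) = √5u/(1 − u²)` — i.e. `g = κ·goldenGerm`: the sharp example of §9a is the UNIQUE tail on its own
abscissae up to a scalar (mechanism: integer Lucas THIRD difference with the coefficients of
`(T − 1)(T² − L₂ₚT + 1)`, Binet kills the jet exactly, identity theorem, then the first Taylor
coefficient `n ≥ 2` after removing `κu` would need `qⁿ ∈ {1, q, q⁻¹}` for `q = ψ²ᵖ ∈ (0,1)`).
(v) MIXED exponential abscissae `N_m = Σ_i λ_iθ_iᵐ` (`θ₁ > θ₂ > ⋯ > 0` real, e.g. `3ᵐ + 2ᵐ`) go the same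
way in several variables `x₀ = θ₁^{-m}`, `x_i = (θ_i/θ₁)ᵐ`: kill the finitely many non-decaying monomials
by an integer polynomial in the shift, then use uniqueness of generalized power sums `Σ c_μ μᵐ` with
distinct `μ` of modulus `< 1` (finitely many per modulus level); for algebraic non-rational `θ_i` the
Galois closure of the killed monomials may spare finitely many decaying ones — the conclusion "finite
exponential polynomial, hence `g` algebraic" survives. Net: the classical sources of log-dense integer
structure (units, integer powers, and their finite mixtures) are ALL rigid.

### §9d WHY NO KILL, and a note on the proof of S (for its prover)
* Adversarial configuration for Schneider's method (not stressed by the two symbolic audits drefute-g0/g2,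
  which book-keep a log-uniform hit set): CLUSTERED hits — `S_j ≈ κ(log X_j)²` hits near scale `X_j`, then
  the maximal gap allowed by `count(X) > ε log X`, `log X_{j+1} ≈ count(X_j)/ε ≈ (κ/ε)(log X_j)²`. Against an
  auxiliary polynomial built on a WHOLE cluster (`D²/2 ≈ S_j` zeros: cost `∝ D·log X_{j+1} ∝ S_j^{3/2}`,
  gain `∝ S_j·log X_j`) the first inter-cluster extrapolation is lost for every `κ > (εθ/c)²` (`θ` = cluster
  spread, `c` = bidegree constant) — the balance is EXACT in the exponents, constants decide nothing. What
  defeats it is keeping the auxiliary polynomial SMALL relative to the zeros it captures: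
  (1) the planner's NEAR-RECORD-LOW start `Y₀` (`r(Y₀) ≈ inf_{X ≥ Y₀} count(X)/log X =: r₀`) yields
  `#(H ∩ (Y₀, K]) ≥ r₀ log(K/Y₀) − o(log Y₀)` for EVERY `K`, hence gain `≥ (r₀/e)·log(K/Y₀)·log Y₀`, linear in
  `log K` with coefficient `∝ log Y₀ ≫ (e+d)D ∝ √(log Y₀)` = cost coefficient: no stall in ANY regime,
  clustered or not (re-checked here at the level of leading exponents). The near-record-low choice is
  ESSENTIAL — from a start right after a cluster the only bound is `#(H ∩ (Y, K]) ≥ ε log K − count(Y)`,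
  vacuous when `count(Y) ≫ ε log Y`, and the jump is lost as above; a prover simplifying it away breaks the
  proof. (2) Backup without minimisation: a CONSTANT number `s ≥ s₀(e, d, r, B)` of constructed zeros
  (bidegree `≈ √(2s)`), extrapolation along all later hits in increasing order, and a STALL-CHAIN LEMMA on
  `T_n := log N_n`: a stall at the first `n > a` with `c√s·T_n + C₁(n − a + s) > Σ_{a−s<i<n} T_i − C₀c√s·T_a`
  forces `T_n ≥ κT_a` (`κ = θ√s/c − C₀ ≥ 4`) and, under `T_n ≤ n/ε + C₂` (¬S), `n ≤ a(1 + O(c√s/(εT_a)))`; the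
  next admissible start (`s` hits within a `θ`-power window) comes `≤ O(s log a)` indices later; chaining,
  `T` grows like `κ^j` while the index stays `≤ 2a₁` — contradicting `T_n ≤ n/ε + C₂` after `O(log a₁)`
  links. Either way S follows; transcendence enters exactly once (`F ≡ 0 ⇒ P(w, h(w)) ≡ 0`).
* Constructions tried this cycle and why they die (one line each, so nobody repeats them): lacunary /
  Stäckel-type series `Σ c_j ∏(1 − N_i z)` (integrality at later nodes needs `c_j` divisible by unbounded
  `N^{d_j − 1}`, else it is the Newton scheme of §9b); additive or multiplicative perturbations of a Pell germ
  ("small + integer-valued on an accumulating set ⇒ 0", or §9c); limits of generalized-Pell families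
  `√(b_k w² + c_k)/√a_k` (uniform limits stay in the 2-parameter algebraic family); linear recurrences with
  dominant root (integrality forces all roots `±λ^{-k}`: Laurent polynomials, §9c); doubling/affine-related
  hit pairs `(N, bN + c)` i.o. (functional equation `(b + cz)G(z/(b+cz)) = bG(z) + Kz`: rational solutions only).
* PRINT (drefute-g2, pages read): Surroca 2002 Thm 3 gives the same `∃ᶠ`-shape with count `(log X)²` for
  algebraic points of bounded degree; Jones–Qiu 2021 Thm 1.2 / JTW 2012 / BMR+ 2025 treat exponentially
  denser regimes; nothing in print contradicts S. This cycle `lit search` was degraded (searchd rc 75); galaxy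
  bm25 reachable (Habegger 2016 "Diophantine approximations on definable sets": `T^ε`-type, another scale).
* Bottom line for the lead: S is TRUE along either route of (1)/(2); it is sharp (§9a) and its extremal
  configurations on Lucas abscissae are classified (§9c). The open content of the line is ★ alone (the
  SC(2)-hard atoms of §3a–c). -/

/-! ### §9a (Lean) The golden tail: S's conclusion fails without transcendence, at the `log X` scale
LANDED as Literature `GoldenGermLogDensity.lean` (p75095, imported above): `goldenGerm`, `goldenJet`,
`cuspHits`, `fib_mem_cuspHits_golden`, `log_le_card_goldenHits`, `eventually_log_lt_card_goldenHits`,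
`not_zeroLogDensity_goldenGerm`, `goldenGerm_algebraic` (the `dslope` construction and the Binet
evaluation follow drefute-g0's `PellTightness.lean`; the density count `≥ ⌊log₃ X⌋` and the exact-format
negation are new). -/


open Filter in
/-- Stub S (`stub_cuspZeroLogDensity`, registered skeleton 1933dd98…) with its TRANSCENDENCE hypothesis
deleted — every other binder verbatim. -/
def StubSWithoutTranscendence : Prop :=
  ∀ (e : ℕ), 0 < e → ∀ (A : Polynomial ℂ) (g : ℂ → ℂ), AnalyticAt ℂ g 0 → g 0 = 0 →
    ∀ ε : ℝ, 0 < ε → ∃ᶠ X : ℕ in atTop,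
      (Nat.card {N : ℕ | N ≤ X ∧ ∃ L : ℤ, A.eval ((((N : ℝ) ^ ((e : ℝ)⁻¹) : ℝ) : ℂ)) +
        g ((((N : ℝ) ^ ((e : ℝ)⁻¹) : ℝ) : ℂ))⁻¹ = L} : ℝ) ≤ ε * Real.log X

/-- **S is false without transcendence — sharply** (§9a): witness `e = 1`, jet `φ·X` (irrational, real),
tail `goldenGerm` (algebraic, non-zero, analytic at `0`, `g 0 = 0`), hits `⊇ {F₂ₙ}`, count `≥ ⌊log₃ X⌋`.
Any proof of S must use the transcendence of the tail, and the `log X` threshold of S is attained on the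
algebraic side. [folklore] -/
theorem stubS_false_without_transcendence : ¬ StubSWithoutTranscendence := fun h =>
  not_zeroLogDensity_goldenGerm
    (h 1 one_pos goldenJet goldenGerm analyticAt_goldenGerm goldenGerm_zero)

open Filter Topology in
/-- … while the registered S is silent about the golden witness only through its transcendence
hypothesis: `goldenGerm` IS algebraic (`X₀X₁² + √5·X₁ − X₀`). [folklore] -/
theorem stubS_hypothesis_excludes_golden :
    ∃ P : MvPolynomial (Fin 2) ℂ, P ≠ 0 ∧
      ∀ᶠ z in 𝓝 (0 : ℂ), MvPolynomial.eval ![z, goldenGerm z] P = 0 :=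
  goldenGerm_algebraic



/-! ### §9c′ (Lean) Rigidity on GEOMETRIC and GOLDEN abscissae — the mechanism of §9c, kernel-checked
LANDED as Literature `GeometricHitRigidity.lean` (p75707) and `GoldenHitRigidity.lean` (p75995), imported
above; re-exported here under stub-S names so that ideators/provers find them from this index.
GEOMETRIC: `c ≥ 2`, `λ ≥ 1` integers, ANY linear jet `αN + α₀` (`α, α₀ ∈ ℂ`), `g` analytic at `0`,
`g 0 = 0`; infinitely many hit triples `λcᵐ, λcᵐ⁺¹, λcᵐ⁺²` force `g ≡ 0` near `0` (integer Lucas second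
difference `c·g(z) − (1+c)·g(z/c) + g(z/c²)` + identity theorem + first Taylor coefficient). So
`{m : λcᵐ hit}` of a non-zero tail has finitely many 3-APs per difference (upper density `0` by Roth).
GOLDEN: `p ≥ 1`; infinitely many Fibonacci 4-progressions `F₂ₘ, F₂₍ₘ₊ₚ₎, F₂₍ₘ₊₂ₚ₎, F₂₍ₘ₊₃ₚ₎` of hits force
`g(z(u)) = κ·u` near `0` with `z(u) = √5u/(1 − u²)` (`z(ψ²ⁿ) = 1/F₂ₙ`), i.e. `g = κ·goldenGerm`: the sharp
example of §9a is the UNIQUE tail on its own abscissae up to a scalar (integer Lucas third difference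
with the coefficients of `(T − 1)(T² − L₂ₚT + 1)`). -/

/-- **Geometric rigidity of stub-S hit sets** (re-export of
`Literature.NumberTheory.Transcendental.eventually_zero_of_frequently_geometric_hits`, p75707).
[folklore] -/
theorem stubS_hits_rigid_on_geometric {c lam : ℕ} (hc : 2 ≤ c) (hlam : 1 ≤ lam) (α α₀ : ℂ)
    {g : ℂ → ℂ} (hg : AnalyticAt ℂ g 0) (hg0 : g 0 = 0)
    (hS : ∃ᶠ m : ℕ in Filter.atTop, ∀ r : ℕ, r ≤ 2 → ∃ L : ℤ,
      α * ((lam * c ^ (m + r) : ℕ) : ℂ) + α₀ + g (((lam * c ^ (m + r) : ℕ) : ℂ))⁻¹ = L) :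
    ∀ᶠ z in nhds (0 : ℂ), g z = 0 :=
  eventually_zero_of_frequently_geometric_hits hc hlam α α₀ hg hg0 hS

/-- **Golden rigidity of stub-S hit sets** (re-export of
`Literature.NumberTheory.Transcendental.golden_rigidity`, p75995): Fibonacci 4-progressions of hits
force `g = κ·goldenGerm` (as `g ∘ goldenZ = κ·id`). [folklore] -/
theorem stubS_hits_rigid_on_golden (p : ℕ) (hp : 1 ≤ p) (α α₀ : ℂ) {g : ℂ → ℂ}
    (hg : AnalyticAt ℂ g 0) (hg0 : g 0 = 0)
    (hS : ∃ᶠ m : ℕ in Filter.atTop, ∀ r : ℕ, r ≤ 3 → ∃ L : ℤ,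
      α * (Nat.fib (2 * (m + r * p)) : ℂ) + α₀ + g ((Nat.fib (2 * (m + r * p)) : ℂ))⁻¹ = L) :
    ∃ κ : ℂ, ∀ᶠ u in nhds (0 : ℂ), g (goldenZ u) = κ * u :=
  golden_rigidity p hp α α₀ hg hg0 hS


/-! ### §9e S's conclusion holds on structured abscissae (landed Literature; to be imported here next)
* `Literature.NumberTheory.Transcendental.geomHitExp_density_zero` (`GeometricHitDensity.lean`, p76236,
  ACCEPTED): for `c ≥ 2`, `λ ≥ 1`, any linear jet `αN + α₀`, `g` analytic at `0` with `g 0 = 0` and not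
  identically zero near `0`, and every `δ > 0`:
  `∀ᶠ X, #{m < X : α·λcᵐ + α₀ + g(1/(λcᵐ)) ∈ ℤ} ≤ δ·X` — Roth's theorem (Mathlib
  `roth_3ap_theorem_nat`) on late windows + §9c′ on ratio `cᵖ` and cosets `λcˢ` + window summation.
  UNCONDITIONAL; so the hits of any non-zero tail lying on a geometric progression are `o(log Y)`.
* `Literature.NumberTheory.Transcendental.fibHitExp_density_zero_of_szemeredi_four`
  (`HitDensitySzemeredi.lean`, p76402): granted `Literature.Combinatorics.Additive.SzemerediFinitary 4`
  (named fact; the tree proves `k ≤ 3`), for a TRANSCENDENTAL `g` (S's hypothesis verbatim) and any linear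
  jet, `∀ δ > 0, ∀ᶠ X, #{m < X : αF₂ₘ + α₀ + g(1/F₂ₘ) ∈ ℤ} ≤ δ·X` — via `golden_rigidity` (p75995) and
  `goldenLinear_implies_algebraic` (`g ∘ goldenZ = κ·id ⇒ g = κ·goldenGerm`, algebraic). So on the very
  abscissae where the sharp ALGEBRAIC example of §9a hits EVERY index, a transcendental tail has a
  density-zero index set.
* The same file's `density_zero_of_eventually_no_AP` is the reusable core: `SzemerediFinitary k` +
  "eventually no `k`-AP of each common difference" ⇒ upper density `0`. -/

/-- Index entry for §9e (no content; see the Literature theorems named in the section docstring).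
[folklore] -/
theorem stubS_structured_abscissae_note : True := trivial

end

end Summit.Schanuel.Schanuel.Cruxes.SparsityTwo.Disproof
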